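import Summits.QuantumFields.BalabanUV.Beta.D1BFx.FineHessianGhostGrades
import Summits.QuantumFields.BalabanUV.Beta.D1BFx.MainTable

/-!
# `BalabanUV.Beta.D1BFx.SplitInstance` — road «BF-x» for binder row D1, slot (SPLIT) ∕ leaf A1.ii, part 5f: THE (SPLIT) IDENTITY AT A BASE SITE, IN
# `D1BFx/Assembly`'s SHAPE — `ω_gl·Kf_gl + ω_gh·Kf_gh = stK μ ν N g + Σ_{τ : RestIdx} restK τ` POINTWISE in the displacement `w`, with the MAIN term an3's
# realised kernel over the frozen profile `g` and EVERY other term a NAMED word of node A0's list (leaf-03-g3's A0-FINE 15 + 81 gluon words and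
# 2 + 16 ghost words by leg grade, the E-sector cross words, the corner term) — under the loop-weight ratio of record displayed as a hypothesis

HONEST DEPENDENCY (page 1, mandatory): continuum YM on T⁴ ⇐ BetaPertH ∧ nine spine estimates (0/9 proved); BetaPertH ⇐ (D1) ∧ (D4) ∧
CAP+tail; G-an2-4 gates asym, D1 and NE2/3/4.  HONEST FRAMING (cell contract, verbatim): «discharging `BetaPertH` makes Bałaban's UV
stability UNCONDITIONAL — a real constructive-QFT result; it is NOT the continuum limit and NOT the Clay problem.»  THIS MODULE DISCHARGES
NOTHING of the wall: [folklore] finite-sum bookkeeping BY NAME over leaf-03-g3's `FineHessianLegGrades.Kf_gluon_eq_gradedTerms` ∕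
`FineHessianGhostGrades.Kf_ghost_eq_gradedTerms` (A0-FINE) and this unit's `MainTable.main_table_eq_bfKernel` (parts 4a∕4b∕5a∕5e); TWO definitions with
bodies ([our objects] `RestIdx`, the finite index of the REST words, and `restK`, the REST word integrands — the TERM LIST of `SPLIT-SPEC.md` §3 as data;
assert nothing).  No `Prop` minted, nothing printed asserted, 0 sorry.  0 wall binders; NOT D1, NOT `BetaPertH`, NOT continuum, NOT Clay.

ABSOLUTE RULE (cell charter, verbatim): «No internally-minted statement may enter as a cited fact. Every hypothesis is either kernel-proved in
this package or a verbatim quotation of a PUBLISHED theorem with page reference. The manuscript(s) under audit are NOT citable for their own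
disputed steps — they are the thing under adjudication; programme-internal (2001/route/tribunal) claims are never citable.»

WHY (`HOME/b2b-balaban-beta-d1-p2/SPLIT-SPEC.md` v1 §§0–4, sub-leaf (5f); `D1BFx/Assembly` slot (SPLIT)).  At a base site `b` with frozen profile `g` (R-10′: the
symmetrised diagonal entry of the gluon leg at `b`), the weighted (F)-integrands of the two fine-loop pieces are finite sums of graded words (A0-FINE).  The
word «E-sector × E-sector over frozen ⊗ frozen» contains the model block `vecK × vecK` (part 4b: `SbE = vecK + DIVₐ + REMₐ`), the ghost word «KIN × KIN over
frozen ⊗ frozen» is the model ghost table, and their weighted sum is `lam·bfKernel g N` at an3's corner (part 5e) — i.e. `stK μ ν N g` at the displacement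
`−w − u_μ` up to the `w_μw_ν` weight (the CORNER TERM, whose full sum vanishes by `FrozenCorner` for an `R_μ`-invariant `g`; here it is just one more named
REST word).  THIS FILE assembles these facts into ONE pointwise identity of the exact shape `Assembly.defect_eq_of_slots` consumes as `hsplit` (at fixed `n`, `b`).
WHAT IT DOES NOT DO: bound any REST word (A2∕A3∕A5∕A6), fix the weights `ω_gl, ω_gh` or the normalisation `n⁻⁸·lam = 1` (slot (K) ∕ CHECK-N0), choose `g`
(R-10′, sub-leaf 5d-leg) — all displayed as parameters ∕ hypotheses.
* §1 helpers: `sum_eq_add_sum_ite_ne` (isolate one term of a finite sum), `sum4_prod` (four nested sums as one sum over the product).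
* §2 [our objects] `RestIdx`, `restK` (tadpole words `(s,r)`, gluon bubble words `(i,j,r,r′) ≠ 0` [the `0000` word replaced by `0`], ghost tadpole words `r`,
  ghost bubble words `(i,j,r,r′) ≠ 0`, and `Fin 2 ↦ {corner, crossE}`); `sum_restK` (the sum over `RestIdx` as the five explicit sums).
* §3 **`split_at_basePoint`**: under `0 < a`, `Spr (Ga n a)`, an exponential bound on `g`, `Loc` of the five slot tables, `g` even, `μ ≠ ν`, and the weight
  hypotheses `hω : ω_gh·cK² = −2·(ω_gl·cE²)`, `hlam : ω_gl·cE² = 2·N²·lam`: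
  `ω_gl·Kf_gl n b w + ω_gh·Kf_gh n b w = stK μ ν N g w + Σ_{τ : RestIdx} restK … τ w` for every `w`.
Unit `b2b-balaban-beta-d1-p2` (road owner, gen 2); `LEAVES-BFx.md` row A1.ii (part 5f) ∕ A0 (assembly).
-/

open Finset
open scoped BigOperators
open Literature.MathematicalPhysics.QuantumFieldTheory.Balaban1983to89
open Literature.MathematicalPhysics.QuantumFieldTheory.Balaban1983to89.Beta
open B12Sec2to5 (l1)
open ExpKernelCalculus (Site MKer bubble)
open DyadicShell (Pt toReal)
open BubbleTransfer (unitVec)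
open SpinTable (bfKernel)
open SquareTable (stK)
open Summit.QuantumFields.BalabanUV.Beta.TameKernelCalculus (Spr Loc)
open Summit.QuantumFields.BalabanUV.Beta.D1BFx.MomentTransferPeriodic (baseKer)
open Summit.QuantumFields.BalabanUV.Beta.D1BFx.GluonLeg (Ga)
open Summit.QuantumFields.BalabanUV.Beta.D1BFx.ReducedKernel (TableR)
open Summit.QuantumFields.BalabanUV.Beta.D1BFx.DressedTablesLeg (tadpoleTableA)
open Summit.QuantumFields.BalabanUV.Beta.D1BFx.ReducedKernelSandwich (fineHess)
open Summit.QuantumFields.BalabanUV.Beta.D1BFx.FineStencilBFBalaban (SbfBal)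
open Summit.QuantumFields.BalabanUV.Beta.D1BFx.SecondStencilBF (Wbf)
open Summit.QuantumFields.BalabanUV.Beta.D1BFx.GluonKernelSectors (SbE secSt secWt secSt_zero secWt_zero)
open Summit.QuantumFields.BalabanUV.Beta.D1BFx.GhostStencil (ghCur)
open Summit.QuantumFields.BalabanUV.Beta.D1BFx.GhostStencilRootedReflection (ctrHalf)
open Summit.QuantumFields.BalabanUV.Beta.D1BFx.GhostAveragingSquare (WghAt)
open Summit.QuantumFields.BalabanUV.Beta.D1BFx.GhostKernelComplete (fineHessGhQ)
open Summit.QuantumFields.BalabanUV.Beta.D1BFx.FineHessianSectors (biBubbleTable biBubbleTable_apply slotWt slotTab)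
open Summit.QuantumFields.BalabanUV.Beta.D1BFx.FineHessianLegGrades (frozenLeg frozenLeg_apply legPiece legPiece_zero Kf_gluon_eq_gradedTerms)
open Summit.QuantumFields.BalabanUV.Beta.D1BFx.FineHessianGhostGrades (ghSec ghWt ghLeg ghLeg_zero Kf_ghost_eq_gradedTerms)
open Summit.QuantumFields.BalabanUV.Beta.D1BFx.MainTable (vecK main_table_eq_bfKernel)

namespace Summit.QuantumFields.BalabanUV.Beta.D1BFx.SplitInstance

/-! ## §1 Two finite-sum helpers -/

/-- [folklore] Isolate one term of a finite sum: `Σ_i f i = f i₀ + Σ_i (if i = i₀ then 0 else f i)`. -/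
theorem sum_eq_add_sum_ite_ne {ι : Type*} [Fintype ι] [DecidableEq ι] (f : ι → ℝ) (i₀ : ι) :
    ∑ i, f i = f i₀ + ∑ i, (if i = i₀ then 0 else f i) := by
  have h0 : f i₀ = ∑ i, (if i = i₀ then f i else 0) := by
    rw [Finset.sum_ite_eq' Finset.univ i₀ f, if_pos (Finset.mem_univ _)]
  rw [h0, ← Finset.sum_add_distrib]
  refine Finset.sum_congr rfl fun i _ => ?_
  split_ifs <;> simp

/-- [folklore] Four nested finite sums as one sum over the product type. -/
theorem sum4_prod {α β γ δ : Type*} [Fintype α] [Fintype β] [Fintype γ] [Fintype δ] (f : α → β → γ → δ → ℝ) :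
    ∑ a, ∑ b, ∑ c, ∑ d, f a b c d = ∑ x : α × β × γ × δ, f x.1 x.2.1 x.2.2.1 x.2.2.2 := by
  simp only [Fintype.sum_prod_type]

/-! ## §2 The REST index and the REST word integrands at a base site -/

/-- [our object] **THE FINITE INDEX OF THE REST WORDS** at a base site: gluon tadpole words `(slot, leg piece)`, gluon bubble words `(sector, sector, leg piece,
leg piece)` (the `(0,0,0,0)` word carries `0` — its model block is MAIN), ghost tadpole words `(leg piece)`, ghost bubble words (same convention), and two
named extras `0 ↦ corner`, `1 ↦ E-sector cross words`.  A DEFINITION (a type); asserts nothing. -/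
abbrev RestIdx : Type := (Fin 5 × Fin 3) ⊕ (Fin 3 × Fin 3 × Fin 3 × Fin 3) ⊕ Fin 2 ⊕ (Fin 2 × Fin 2 × Fin 2 × Fin 2) ⊕ Fin 2

section Words

/-- [our object] **THE REST WORD INTEGRANDS** at the base site `b`, displacement `w` (the TERM LIST of `SPLIT-SPEC.md` §3 as data).  A DEFINITION; asserts nothing. -/
noncomputable def restK (n : ℕ) [NeZero n] (a : ℝ) (g : Pt → ℝ) (cE cΛ cR cK cQ cE₂ cJ4 cΛ₂ cR₂ cQ₂ x₀ : ℝ) (WE WJ WΛ WR WQ : TableR)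
    (ωgl ωgh lam N : ℝ) (μ ν : Fin 4) (b : Pt) : RestIdx → Pt → ℝ
  | Sum.inl x => fun w => ωgl * (slotWt cE₂ cJ4 cΛ₂ cR₂ cQ₂ x.1 *
      (((n : ℝ) ^ 8)⁻¹ * (toReal w μ * toReal w ν * baseKer (tadpoleTableA (legPiece n a g x.2) (slotTab WE WJ WΛ WR WQ x.1) μ ν) b w)))
  | Sum.inr (Sum.inl x) => fun w => ωgl * (if x = ((0 : Fin 3), (0 : Fin 3), (0 : Fin 3), (0 : Fin 3)) then 0 else
      secWt cE cΛ cR x.1 * secWt cE cΛ cR x.2.1 *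
        (((n : ℝ) ^ 8)⁻¹ * (toReal w μ * toReal w ν *
          baseKer (biBubbleTable (legPiece n a g x.2.2.1) (legPiece n a g x.2.2.2) (secSt n a cK cQ x.1) (secSt n a cK cQ x.2.1) μ ν) b w)))
  | Sum.inr (Sum.inr (Sum.inl r)) => fun w => ωgh *
      (((n : ℝ) ^ 8)⁻¹ * (toReal w μ * toReal w ν * baseKer (tadpoleTableA (ghLeg n a g r) (WghAt (ctrHalf n) n x₀ cK cQ) μ ν) b w))
  | Sum.inr (Sum.inr (Sum.inr (Sum.inl x))) => fun w => ωgh * (if x = ((0 : Fin 2), (0 : Fin 2), (0 : Fin 2), (0 : Fin 2)) then 0 else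
      ghWt cK cQ x.1 * ghWt cK cQ x.2.1 *
        (((n : ℝ) ^ 8)⁻¹ * (toReal w μ * toReal w ν *
          baseKer (biBubbleTable (ghLeg n a g x.2.2.1) (ghLeg n a g x.2.2.2) (ghSec n x.1) (ghSec n x.2.1) μ ν) b w)))
  | Sum.inr (Sum.inr (Sum.inr (Sum.inr k))) => fun w => if k = 0 then
        ((n : ℝ) ^ 8)⁻¹ * (toReal w μ * toReal w ν * (lam * bfKernel g N (unitVec μ) (unitVec ν) (-w - unitVec μ))) - stK μ ν N g w
      else ωgl * (cE * cE * (((n : ℝ) ^ 8)⁻¹ * (toReal w μ * toReal w ν *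
        (-(1 / 2 : ℝ) * (bubble (frozenLeg g : MKer 4 (Fin 4)) (SbE μ (b + w)) (SbE ν b)
          - bubble (frozenLeg g : MKer 4 (Fin 4)) (vecK μ (b + w)) (vecK ν b))))))

variable (n : ℕ) [NeZero n] (a : ℝ) (g : Pt → ℝ) (cE cΛ cR cK cQ cE₂ cJ4 cΛ₂ cR₂ cQ₂ x₀ : ℝ) (WE WJ WΛ WR WQ : TableR)
  (ωgl ωgh lam N : ℝ) (μ ν : Fin 4) (b : Pt)

/-- [our object] Unfolding: gluon tadpole words. -/
theorem restK_tad (x : Fin 5 × Fin 3) (w : Pt) :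
    restK n a g cE cΛ cR cK cQ cE₂ cJ4 cΛ₂ cR₂ cQ₂ x₀ WE WJ WΛ WR WQ ωgl ωgh lam N μ ν b (Sum.inl x) w =
      ωgl * (slotWt cE₂ cJ4 cΛ₂ cR₂ cQ₂ x.1 *
        (((n : ℝ) ^ 8)⁻¹ * (toReal w μ * toReal w ν * baseKer (tadpoleTableA (legPiece n a g x.2) (slotTab WE WJ WΛ WR WQ x.1) μ ν) b w))) := rfl

/-- [our object] Unfolding: gluon bubble words (the `0000` word replaced by `0`). -/
theorem restK_bub (x : Fin 3 × Fin 3 × Fin 3 × Fin 3) (w : Pt) :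
    restK n a g cE cΛ cR cK cQ cE₂ cJ4 cΛ₂ cR₂ cQ₂ x₀ WE WJ WΛ WR WQ ωgl ωgh lam N μ ν b (Sum.inr (Sum.inl x)) w =
      ωgl * (if x = ((0 : Fin 3), (0 : Fin 3), (0 : Fin 3), (0 : Fin 3)) then 0 else
        secWt cE cΛ cR x.1 * secWt cE cΛ cR x.2.1 *
          (((n : ℝ) ^ 8)⁻¹ * (toReal w μ * toReal w ν *
            baseKer (biBubbleTable (legPiece n a g x.2.2.1) (legPiece n a g x.2.2.2) (secSt n a cK cQ x.1) (secSt n a cK cQ x.2.1) μ ν) b w))) := rfl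

/-- [our object] Unfolding: ghost tadpole words. -/
theorem restK_gtad (r : Fin 2) (w : Pt) :
    restK n a g cE cΛ cR cK cQ cE₂ cJ4 cΛ₂ cR₂ cQ₂ x₀ WE WJ WΛ WR WQ ωgl ωgh lam N μ ν b (Sum.inr (Sum.inr (Sum.inl r))) w =
      ωgh * (((n : ℝ) ^ 8)⁻¹ * (toReal w μ * toReal w ν * baseKer (tadpoleTableA (ghLeg n a g r) (WghAt (ctrHalf n) n x₀ cK cQ) μ ν) b w)) := rfl

/-- [our object] Unfolding: ghost bubble words (the `0000` word replaced by `0`). -/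
theorem restK_gbub (x : Fin 2 × Fin 2 × Fin 2 × Fin 2) (w : Pt) :
    restK n a g cE cΛ cR cK cQ cE₂ cJ4 cΛ₂ cR₂ cQ₂ x₀ WE WJ WΛ WR WQ ωgl ωgh lam N μ ν b (Sum.inr (Sum.inr (Sum.inr (Sum.inl x)))) w =
      ωgh * (if x = ((0 : Fin 2), (0 : Fin 2), (0 : Fin 2), (0 : Fin 2)) then 0 else
        ghWt cK cQ x.1 * ghWt cK cQ x.2.1 *
          (((n : ℝ) ^ 8)⁻¹ * (toReal w μ * toReal w ν *
            baseKer (biBubbleTable (ghLeg n a g x.2.2.1) (ghLeg n a g x.2.2.2) (ghSec n x.1) (ghSec n x.2.1) μ ν) b w))) := rfl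

/-- [our object] Unfolding: the corner word. -/
theorem restK_corner (w : Pt) :
    restK n a g cE cΛ cR cK cQ cE₂ cJ4 cΛ₂ cR₂ cQ₂ x₀ WE WJ WΛ WR WQ ωgl ωgh lam N μ ν b (Sum.inr (Sum.inr (Sum.inr (Sum.inr 0)))) w =
      ((n : ℝ) ^ 8)⁻¹ * (toReal w μ * toReal w ν * (lam * bfKernel g N (unitVec μ) (unitVec ν) (-w - unitVec μ))) - stK μ ν N g w := rfl

/-- [our object] Unfolding: the E-sector cross words. -/
theorem restK_crossE (w : Pt) :
    restK n a g cE cΛ cR cK cQ cE₂ cJ4 cΛ₂ cR₂ cQ₂ x₀ WE WJ WΛ WR WQ ωgl ωgh lam N μ ν b (Sum.inr (Sum.inr (Sum.inr (Sum.inr 1)))) w =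
      ωgl * (cE * cE * (((n : ℝ) ^ 8)⁻¹ * (toReal w μ * toReal w ν *
        (-(1 / 2 : ℝ) * (bubble (frozenLeg g : MKer 4 (Fin 4)) (SbE μ (b + w)) (SbE ν b)
          - bubble (frozenLeg g : MKer 4 (Fin 4)) (vecK μ (b + w)) (vecK ν b)))))) := rfl

/-- [folklore] **THE SUM OVER THE REST INDEX AS SIX EXPLICIT PIECES.** -/
theorem sum_restK (w : Pt) :
    ∑ τ : RestIdx, restK n a g cE cΛ cR cK cQ cE₂ cJ4 cΛ₂ cR₂ cQ₂ x₀ WE WJ WΛ WR WQ ωgl ωgh lam N μ ν b τ w =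
      ωgl * (∑ x : Fin 5 × Fin 3, slotWt cE₂ cJ4 cΛ₂ cR₂ cQ₂ x.1 *
        (((n : ℝ) ^ 8)⁻¹ * (toReal w μ * toReal w ν * baseKer (tadpoleTableA (legPiece n a g x.2) (slotTab WE WJ WΛ WR WQ x.1) μ ν) b w)))
      + ωgl * (∑ x : Fin 3 × Fin 3 × Fin 3 × Fin 3, if x = ((0 : Fin 3), (0 : Fin 3), (0 : Fin 3), (0 : Fin 3)) then 0 else
          secWt cE cΛ cR x.1 * secWt cE cΛ cR x.2.1 *
            (((n : ℝ) ^ 8)⁻¹ * (toReal w μ * toReal w ν *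
              baseKer (biBubbleTable (legPiece n a g x.2.2.1) (legPiece n a g x.2.2.2) (secSt n a cK cQ x.1) (secSt n a cK cQ x.2.1) μ ν) b w)))
      + ωgh * (∑ r : Fin 2, ((n : ℝ) ^ 8)⁻¹ * (toReal w μ * toReal w ν * baseKer (tadpoleTableA (ghLeg n a g r) (WghAt (ctrHalf n) n x₀ cK cQ) μ ν) b w))
      + ωgh * (∑ x : Fin 2 × Fin 2 × Fin 2 × Fin 2, if x = ((0 : Fin 2), (0 : Fin 2), (0 : Fin 2), (0 : Fin 2)) then 0 else
          ghWt cK cQ x.1 * ghWt cK cQ x.2.1 *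
            (((n : ℝ) ^ 8)⁻¹ * (toReal w μ * toReal w ν *
              baseKer (biBubbleTable (ghLeg n a g x.2.2.1) (ghLeg n a g x.2.2.2) (ghSec n x.1) (ghSec n x.2.1) μ ν) b w)))
      + ((((n : ℝ) ^ 8)⁻¹ * (toReal w μ * toReal w ν * (lam * bfKernel g N (unitVec μ) (unitVec ν) (-w - unitVec μ))) - stK μ ν N g w)
        + ωgl * (cE * cE * (((n : ℝ) ^ 8)⁻¹ * (toReal w μ * toReal w ν *
          (-(1 / 2 : ℝ) * (bubble (frozenLeg g : MKer 4 (Fin 4)) (SbE μ (b + w)) (SbE ν b)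
            - bubble (frozenLeg g : MKer 4 (Fin 4)) (vecK μ (b + w)) (vecK ν b))))))) := by
  rw [Fintype.sum_sum_type, Fintype.sum_sum_type, Fintype.sum_sum_type, Fintype.sum_sum_type]
  have hk : ∑ k : Fin 2, restK n a g cE cΛ cR cK cQ cE₂ cJ4 cΛ₂ cR₂ cQ₂ x₀ WE WJ WΛ WR WQ ωgl ωgh lam N μ ν b (Sum.inr (Sum.inr (Sum.inr (Sum.inr k)))) w
      = restK n a g cE cΛ cR cK cQ cE₂ cJ4 cΛ₂ cR₂ cQ₂ x₀ WE WJ WΛ WR WQ ωgl ωgh lam N μ ν b (Sum.inr (Sum.inr (Sum.inr (Sum.inr 0)))) w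
        + restK n a g cE cΛ cR cK cQ cE₂ cJ4 cΛ₂ cR₂ cQ₂ x₀ WE WJ WΛ WR WQ ωgl ωgh lam N μ ν b (Sum.inr (Sum.inr (Sum.inr (Sum.inr 1)))) w :=
    Fin.sum_univ_two _
  rw [hk, restK_corner, restK_crossE]
  simp only [restK_tad, restK_bub, restK_gtad, restK_gbub, ← Finset.mul_sum]
  ring

end Words

/-! ## §3 The (SPLIT) identity at a base site -/

section Split

variable (n : ℕ) [NeZero n] (a : ℝ) {g : Pt → ℝ} (cE cVH cΛ cR cK cQ cE₂ cJ4 cΛ₂ cR₂ cQ₂ x₀ : ℝ) (WE WJ WΛ WR WQ : TableR)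
  {ωgl ωgh lam N : ℝ} {μ ν : Fin 4}

/-- [folklore] **THE (SPLIT) IDENTITY AT A BASE SITE.**  `0 < a`, `Spr (Ga n a)`, frozen profile `g` exponentially bounded and EVEN, `Loc` of the five
second-order slot tables, `μ ≠ ν`, and the weights in the loop-weight ratio of record (`hω`) with the normalisation named `lam` (`hlam`).  Then for every
displacement `w`:
`ω_gl·[n⁻⁸·w_μw_ν·baseKer (fineHess n a SbfBal Wbf μ ν) b w] + ω_gh·[n⁻⁸·w_μw_ν·baseKer (fineHessGhQ n a x₀ cK cQ μ ν) b w] = stK μ ν N g w + Σ_{τ : RestIdx} restK … τ w`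
— the `hsplit` binder of `D1BFx/Assembly` at `(n, b)` for `ι = {gl, gh}`, `T = RestIdx`, MAIN = an3's `stK` over the frozen profile. -/
theorem split_at_basePoint (ha : 0 < a) (hGa : Spr (Ga n a)) {C δ : ℝ} (hδ : 0 < δ) (hg : ∀ v, |g v| ≤ C * Real.exp (-δ * l1 v))
    (hgev : ∀ w, g (-w) = g w) (hE : ∀ κ u l u', Loc (WE κ u l u')) (hJ : ∀ κ u l u', Loc (WJ κ u l u'))
    (hΛ : ∀ κ u l u', Loc (WΛ κ u l u')) (hR : ∀ κ u l u', Loc (WR κ u l u')) (hQ : ∀ κ u l u', Loc (WQ κ u l u'))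
    (hμν : μ ≠ ν) (hω : ωgh * cK ^ 2 = -2 * (ωgl * cE ^ 2)) (hlam : ωgl * cE ^ 2 = 2 * N ^ 2 * lam) (b w : Pt) :
    ωgl * (((n : ℝ) ^ 8)⁻¹ * (toReal w μ * toReal w ν *
        baseKer (fineHess n a (SbfBal n a cE cVH cΛ cR cK cQ) (Wbf cE₂ cJ4 cΛ₂ cR₂ cQ₂ WE WJ WΛ WR WQ) μ ν) b w))
      + ωgh * (((n : ℝ) ^ 8)⁻¹ * (toReal w μ * toReal w ν * baseKer (fineHessGhQ n a x₀ cK cQ μ ν) b w)) =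
      stK μ ν N g w + ∑ τ : RestIdx, restK n a g cE cΛ cR cK cQ cE₂ cJ4 cΛ₂ cR₂ cQ₂ x₀ WE WJ WΛ WR WQ ωgl ωgh lam N μ ν b τ w := by
  -- the two graded expansions (A0-FINE) and the REST sum in pieces
  rw [Kf_gluon_eq_gradedTerms n a cE cVH cΛ cR cK cQ cE₂ cJ4 cΛ₂ cR₂ cQ₂ WE WJ WΛ WR WQ ha hGa hδ hg hE hJ hΛ hR hQ μ ν b w,
    Kf_ghost_eq_gradedTerms n a cK cQ x₀ ha hδ hg μ ν b w, sum_restK]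
  -- nested sums as sums over products; isolate the two `0000` bubble words
  rw [Fintype.sum_prod_type' (fun s r => slotWt cE₂ cJ4 cΛ₂ cR₂ cQ₂ s * (((n : ℝ) ^ 8)⁻¹ * (toReal w μ * toReal w ν *
      baseKer (tadpoleTableA (legPiece n a g r) (slotTab WE WJ WΛ WR WQ s) μ ν) b w)))]
  rw [sum4_prod (fun i j r r' => secWt cE cΛ cR i * secWt cE cΛ cR j * (((n : ℝ) ^ 8)⁻¹ * (toReal w μ * toReal w ν *
      baseKer (biBubbleTable (legPiece n a g r) (legPiece n a g r') (secSt n a cK cQ i) (secSt n a cK cQ j) μ ν) b w))),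
    sum4_prod (fun i j r r' => ghWt cK cQ i * ghWt cK cQ j * (((n : ℝ) ^ 8)⁻¹ * (toReal w μ * toReal w ν *
      baseKer (biBubbleTable (ghLeg n a g r) (ghLeg n a g r') (ghSec n i) (ghSec n j) μ ν) b w))),
    sum_eq_add_sum_ite_ne (fun x : Fin 3 × Fin 3 × Fin 3 × Fin 3 => secWt cE cΛ cR x.1 * secWt cE cΛ cR x.2.1 * (((n : ℝ) ^ 8)⁻¹ *
      (toReal w μ * toReal w ν * baseKer (biBubbleTable (legPiece n a g x.2.2.1) (legPiece n a g x.2.2.2) (secSt n a cK cQ x.1)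
        (secSt n a cK cQ x.2.1) μ ν) b w))) ((0 : Fin 3), (0 : Fin 3), (0 : Fin 3), (0 : Fin 3)),
    sum_eq_add_sum_ite_ne (fun x : Fin 2 × Fin 2 × Fin 2 × Fin 2 => ghWt cK cQ x.1 * ghWt cK cQ x.2.1 * (((n : ℝ) ^ 8)⁻¹ *
      (toReal w μ * toReal w ν * baseKer (biBubbleTable (ghLeg n a g x.2.2.1) (ghLeg n a g x.2.2.2) (ghSec n x.1) (ghSec n x.2.1) μ ν) b w)))
      ((0 : Fin 2), (0 : Fin 2), (0 : Fin 2), (0 : Fin 2))]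
  -- the model block of the gluon `0000` word plus the ghost `0000` word is `lam·bfKernel` at an3's corner
  have hposv : vecK ν b = vecK ν ((b + w) + ((-w - unitVec μ) + unitVec μ)) := by congr 1; abel
  have hposg : ghCur ν b = ghCur ν ((b + w) + ((-w - unitVec μ) + unitVec μ)) := by congr 1; abel
  have hmain : ωgl * (-(1 / 2 : ℝ) * (cE ^ 2 * bubble (frozenLeg g : MKer 4 (Fin 4)) (vecK μ (b + w)) (vecK ν b)))
      + ωgh * (-(1 / 2 : ℝ) * (cK ^ 2 * bubble (frozenLeg g : MKer 4 Unit) (ghCur μ (b + w)) (ghCur ν b))) =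
      lam * bfKernel g N (unitVec μ) (unitVec ν) (-w - unitVec μ) := by
    rw [hposv, hposg]
    exact main_table_eq_bfKernel g hgev (fun x y a' b' => frozenLeg_apply g x y a' b') (fun x y a' b' => frozenLeg_apply g x y a' b') hμν hω hlam
      (b + w) (-w - unitVec μ)
  -- the two isolated words in explicit form
  have e1 : secWt cE cΛ cR 0 * secWt cE cΛ cR 0 * (((n : ℝ) ^ 8)⁻¹ * (toReal w μ * toReal w ν *
      baseKer (biBubbleTable (legPiece n a g 0) (legPiece n a g 0) (secSt n a cK cQ 0) (secSt n a cK cQ 0) μ ν) b w)) =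
      cE * cE * (((n : ℝ) ^ 8)⁻¹ * (toReal w μ * toReal w ν * (-(1 / 2 : ℝ) * bubble (frozenLeg g : MKer 4 (Fin 4)) (SbE μ (b + w)) (SbE ν b)))) := by
    rw [secWt_zero, secSt_zero, legPiece_zero, baseKer, biBubbleTable_apply]
    rfl
  have e2 : ghWt cK cQ 0 * ghWt cK cQ 0 * (((n : ℝ) ^ 8)⁻¹ * (toReal w μ * toReal w ν *
      baseKer (biBubbleTable (ghLeg n a g 0) (ghLeg n a g 0) (ghSec n 0) (ghSec n 0) μ ν) b w)) =
      cK * cK * (((n : ℝ) ^ 8)⁻¹ * (toReal w μ * toReal w ν * (-(1 / 2 : ℝ) * bubble (frozenLeg g : MKer 4 Unit) (ghCur μ (b + w)) (ghCur ν b)))) := by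
    rw [ghLeg_zero, baseKer, biBubbleTable_apply]
    rfl
  simp only [e1, e2]
  linear_combination (((n : ℝ) ^ 8)⁻¹ * (toReal w μ * toReal w ν)) * hmain

end Split

end Summit.QuantumFields.BalabanUV.Beta.D1BFx.SplitInstance
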